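import Literature.AlgebraicGeometry.Modules.PullbackFrame
import Literature.AlgebraicGeometry.Modules.LocalExactness
import Literature.AlgebraicGeometry.Modules.LinearOverBase
import Mathlib.AlgebraicGeometry.Morphisms.ClosedImmersion
import HarnessLib

/-!
# The restriction of a finite locally free module to a closed subscheme cut out by a function:
# `F ⊗ 𝒪_Z = F/aF`

Let `ι : Z → X` be a closed immersion of schemes and `F` a finite locally free `𝒪_X`-module. The unit
`η_F : F → ι_*ι^*F` of the adjunction `ι^* ⊣ ι_*` (tree `pullbackUnit`, sections `b ↦ η(b)`,
`Modules/PullbackUnitSections.lean`) is then an EPIMORPHISM (`epi_pullbackUnit`): over a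
trivialising affine open `W`, a section of `ι^*F` over `ι⁻¹W` is a combination of the pulled-back
basis sections (the pulled-back frame, `Modules/PullbackFrame.lean`) whose coefficients lift along the
surjection `Γ(W, 𝒪_X) → Γ(ι⁻¹W, 𝒪_Z)` (`Scheme.Hom.app_surjective`); outside the closed image of `ι`
everything vanishes. If moreover `a ∈ Γ(X, 𝒪_X)` is a global function with `ι♯(a) = 0` whose
restrictions generate the kernel of `ι♯` on affine opens (`Z = V(a)` scheme-theoretically, e.g. the
thickenings `X ⊗ A/Iⁿ` of a scheme over a ring `A` with `I = (a)` principal), then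

  `F —a→ F —η→ ι_*ι^*F → 0`

is EXACT (`exact_globalScalar_pullbackUnit`; `globalScalar F a` is multiplication by `a`,
`Modules/LinearOverBase.lean`): a section killed by `η` has, in a frame over an affine `W`,
coordinates in `ker ι♯ = (a|_W)`. Hence **`ι_*ι^*F ≅ F/aF = coker(a : F → F)`**, compatibly with
`η` and the cokernel projection (`cokernelGlobalScalarIso`, `cokernel_π_cokernelGlobalScalarIso_hom`).
This is the finite-locally-free case of The Stacks Project, Tag 08KS (Modules, Lemma 17.13.4:
for a closed immersion of ringed spaces with ideal `𝓘`, `i_*i^*𝓕 = 𝓕/𝓘𝓕`) and of Hartshorne II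
Prop. 5.8/Ex. 5.1 (`f^*` of a locally free sheaf in frames); it is the form in which the tree's
formal-existence arguments (`Morphisms/FormalFunctionsModule*`: formal modules as compatible systems
of the `F/aⁿ⁺¹F`) meet restrictions `ι_n^*F` to thickenings (`Motives/GrothendieckExistenceWitt`).

Everything is proved; no named facts.

## References

* The Stacks Project, Tag 08KS (Modules on Spaces, Lemma 17.13.4), Tag 01QY. [StacksProject]
* R. Hartshorne, *Algebraic Geometry*, GTM 52 (1977), II.5 (p. 110), Prop. 5.8. [Hartshorne1977]
-/

noncomputable section

open CategoryTheory AlgebraicGeometry Limits TopologicalSpace Opposite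

universe u

namespace Literature.AlgebraicGeometry.Modules

open Literature.AlgebraicGeometry.Motives

variable {Z X : Scheme.{u}} (ι : Z ⟶ X)

/-! ## A global function vanishing on `Z` kills direct images from `Z` -/

/-- **A global function `a` with `ι♯(a) = 0` acts by zero on every direct image `ι_*P`**
(`Γ(V, ι_*P) = Γ(ι⁻¹V, P)` with `Γ(V, 𝒪_X)` acting through `ι♯`). [folklore] -/
theorem globalScalar_pushforward_eq_zero {a : Γ(X, ⊤)} (ha : ι.appTop a = 0) (P : Z.Modules) :
    globalScalar ((Scheme.Modules.pushforward ι).obj P) a = 0 := by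
  refine Scheme.Modules.hom_ext _ _ fun V => ?_
  ext s
  change (globalScalar ((Scheme.Modules.pushforward ι).obj P) a).app V s = (0 : Γ(P, ι ⁻¹ᵁ V))
  rw [globalScalar_app_apply]
  change ι.app V (X.presheaf.map (homOfLE (le_top : V ≤ ⊤)).op a) • (show Γ(P, ι ⁻¹ᵁ V) from s) = 0
  have h : ι.app V (X.presheaf.map (homOfLE (le_top : V ≤ ⊤)).op a) = 0 := by
    have h' := congrArg (fun φ => φ.hom a) (ι.naturality (homOfLE (le_top : V ≤ ⊤)).op)
    change ι.app V (X.presheaf.map (homOfLE (le_top : V ≤ ⊤)).op a) =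
      Z.presheaf.map _ (ι.appTop a) at h'
    rw [h', ha, map_zero]
  rw [h, zero_smul]

/-- Hence `a ∘ η_F = η_F ∘ a = 0` for the unit `η_F : F → ι_*ι^*F`: the sequence
`F —a→ F —η→ ι_*ι^*F` is a complex. [folklore] -/
@[reassoc]
theorem globalScalar_comp_pullbackUnit {a : Γ(X, ⊤)} (ha : ι.appTop a = 0) (F : X.Modules) :
    globalScalar F a ≫ pullbackUnit ι F = 0 := by
  rw [globalScalar_comp, globalScalar_pushforward_eq_zero ι ha, comp_zero]

/-! ## The unit is an epimorphism for a closed immersion and a finite locally free module -/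

/-- A morphism of `𝒪_X`-modules which is locally surjective on sections is an epimorphism (Mathlib
`TopCat.Sheaf.isLocallySurjective_iff_epi` for the underlying sheaves of groups; cf. the tree's
`SerreTwist.epi_of_locallySurjective`, not imported here to keep this file light). [folklore] -/
private theorem epi_of_locallySurjective' {M N : X.Modules} (φ : M ⟶ N)
    (h : ∀ (U : X.Opens) (t : Γ(N, U)) (x : X), x ∈ U →
      ∃ (V : X.Opens) (_ : V ≤ U), x ∈ V ∧
        ∃ s : Γ(M, V), φ.app V s = N.presheaf.map (homOfLE ‹V ≤ U›).op t) :
    Epi φ := by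
  have hls : TopCat.Presheaf.IsLocallySurjective φ.mapPresheaf := by
    rw [TopCat.Presheaf.isLocallySurjective_iff]
    intro U t x hx
    obtain ⟨V, hVU, hxV, s, hs⟩ := h U t x hx
    exact ⟨V, hVU, ⟨s, hs⟩, hxV⟩
  have h1 : Epi ((SheafOfModules.toSheaf X.ringCatSheaf).map φ) :=
    (TopCat.Sheaf.isLocallySurjective_iff_epi _).mp hls
  exact (SheafOfModules.toSheaf X.ringCatSheaf).epi_of_epi_map h1

/-- Sections of an `𝒪_Z`-module over the preimage of an open missing the image of `ι` agree (the
preimage is empty). [folklore] -/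
theorem eq_of_preimage_eq_bot (P : Z.Modules) {W : X.Opens} (hW : ∀ z : Z, ι.base z ∉ W)
    (s t : Γ(P, ι ⁻¹ᵁ W)) : s = t :=
  TopCat.Sheaf.eq_of_locally_eq' (⟨P.presheaf, P.isSheaf⟩ : TopCat.Sheaf Ab Z)
    (fun i : PEmpty.{u + 1} => (i.elim : Z.Opens)) (ι ⁻¹ᵁ W) (fun i => i.elim)
    (fun z hz => (hW z hz).elim) s t fun i => i.elim

variable [IsClosedImmersion ι]

/-- **The unit `η_F : F → ι_*ι^*F` is an epimorphism for `ι` a closed immersion and `F` finite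
locally free**: over a trivialising affine `W`, `t ∈ Γ(ι⁻¹W, ι^*F)` is `∑ᵢ dᵢ η(bᵢ)|` in the
pulled-back frame, and `dᵢ = ι♯(cᵢ)` (`Γ(W, 𝒪_X) → Γ(ι⁻¹W, 𝒪_Z)` is onto), so `t = η(∑ᵢ cᵢ bᵢ|_W)`;
off the (closed) image of `ι` the target vanishes.
[cite: StacksProject, Tag 08KS (Modules, Lemma 17.13.4)] -/
theorem epi_pullbackUnit {F : X.Modules} (hF : IsFiniteLocallyFree F) :
    Epi (pullbackUnit ι F) := by
  classical
  refine epi_of_locallySurjective' _ fun V t x hxV => ?_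
  by_cases hx : x ∈ Set.range ι.base
  · obtain ⟨z, rfl⟩ := hx
    obtain ⟨U, hxU, I, hI, ⟨e⟩⟩ := hF (ι.base z)
    haveI := Fintype.ofFinite I
    obtain ⟨W, hWaff, hxW, hWle⟩ := (Opens.isBasis_iff_nbhd.mp X.isBasis_affineOpens)
      (show ι.base z ∈ U ⊓ V from ⟨hxU, hxV⟩)
    have hWU : W ≤ U := hWle.trans inf_le_left
    have hWV : W ≤ V := hWle.trans inf_le_right
    refine ⟨W, hWV, hxW, ?_⟩
    -- the restricted section `t' = t|_{ι⁻¹W}` and its coordinates in the pulled-back frame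
    obtain ⟨t', ht'⟩ : ∃ t' : Γ((Scheme.Modules.pullback ι).obj F, ι ⁻¹ᵁ W),
        t' = ((Scheme.Modules.pullback ι).obj F).presheaf.map
          ((Opens.map ι.base).map (homOfLE hWV)).op t := ⟨_, rfl⟩
    have hsurj := ι.app_surjective W hWaff
    choose c hc using fun i => hsurj (coord (E := (Scheme.Modules.pullback ι).obj F)
      (pullbackFrame ι e) ((Opens.map ι.base).map (homOfLE hWU)) t' i)
    refine ⟨∑ i, c i • F.presheaf.map (homOfLE hWU).op (basisSection e i), ?_⟩
    change unitSection ι F W (∑ i, c i • F.presheaf.map (homOfLE hWU).op (basisSection e i)) =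
      ((Scheme.Modules.pullback ι).obj F).presheaf.map ((Opens.map ι.base).map (homOfLE hWV)).op t
    rw [← ht', unitSection_sum]
    conv_rhs => rw [eq_sum_coord_smul (E := (Scheme.Modules.pullback ι).obj F) (pullbackFrame ι e)
      ((Opens.map ι.base).map (homOfLE hWU)) t']
    refine Finset.sum_congr rfl fun i _ => ?_
    rw [unitSection_smul, hc, unitSection_map, basisSection_pullbackFrame]
  · -- off the closed image of `ι` the sections of `ι_*ι^*F` vanish
    let W : X.Opens :=
      V ⊓ ⟨(Set.range ι.base)ᶜ, ι.isClosedEmbedding.isClosed_range.isOpen_compl⟩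
    have hWV : W ≤ V := inf_le_left
    refine ⟨W, hWV, ⟨hxV, hx⟩, 0, ?_⟩
    exact eq_of_preimage_eq_bot ι _
      (fun z hz => (show ι.base z ∈ (V : Set X) ∩ (Set.range ι.base)ᶜ from hz).2 ⟨z, rfl⟩) _ _

/-! ## Exactness of `F —a→ F —η→ ι_*ι^*F` when `Z = V(a)` -/

omit [IsClosedImmersion ι] in
/-- **Exactness at `F`**: for `ι : Z → X` a morphism whose kernel ideal is generated, on every affine
open `W`, by the restriction of the global function `a` (`ker ι♯_W = (a|_W)`), with `ι♯(a) = 0`, and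
`F` finite locally free, the complex `F —a→ F —η→ ι_*ι^*F` is exact: a section `s` with `η(s) = 0`
has, over a trivialising affine `W`, coordinates `cᵢ` with `ι♯(cᵢ) = 0` (uniqueness of coordinates in
the pulled-back frame), so `cᵢ = a|_W cᵢ'` and `s|_W = a · ∑ᵢ cᵢ' bᵢ|_W`.
[cite: StacksProject, Tag 08KS (Modules, Lemma 17.13.4)] -/
theorem exact_globalScalar_pullbackUnit {F : X.Modules} (hF : IsFiniteLocallyFree F)
    {a : Γ(X, ⊤)} (ha : ι.appTop a = 0)
    (hker : ∀ W : X.Opens, IsAffineOpen W → ∀ c : Γ(X, W), ι.app W c = 0 →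
      ∃ c' : Γ(X, W), c = X.presheaf.map (homOfLE (le_top : W ≤ ⊤)).op a * c') :
    (ShortComplex.mk (globalScalar F a) (pullbackUnit ι F)
      (globalScalar_comp_pullbackUnit ι ha F)).Exact := by
  classical
  refine exact_of_locally_exact _ fun V s hs x hxV => ?_
  change (pullbackUnit ι F).app V s = 0 at hs
  obtain ⟨U, hxU, I, hI, ⟨e⟩⟩ := hF x
  haveI := Fintype.ofFinite I
  obtain ⟨W, hWaff, hxW, hWle⟩ := (Opens.isBasis_iff_nbhd.mp X.isBasis_affineOpens)
    (show x ∈ U ⊓ V from ⟨hxU, hxV⟩)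
  have hWU : W ≤ U := hWle.trans inf_le_left
  have hWV : W ≤ V := hWle.trans inf_le_right
  refine ⟨W, homOfLE hWV, hxW, ?_⟩
  -- the restricted section `sW = s|_W`, its coordinates `c` in the frame `e`
  obtain ⟨sW, hsW⟩ : ∃ sW : Γ(F, W), sW = F.presheaf.map (homOfLE hWV).op s := ⟨_, rfl⟩
  obtain ⟨c, hc⟩ : ∃ c : I → Γ(X, W), c = coord e (homOfLE hWU) sW := ⟨_, rfl⟩
  -- `η(s|_W) = η(s)|_{ι⁻¹W} = 0`
  have hηsW : unitSection ι F W sW = 0 := by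
    rw [hsW, unitSection_map, show unitSection ι F V s = 0 from hs]
    exact map_zero _
  -- `0 = η(s|_W) = ∑ᵢ ι♯(cᵢ) η(bᵢ)|`, so `ι♯(c_j) = 0` by uniqueness of coordinates
  have hexp : unitSection ι F W sW = ∑ i, ι.app W (c i) •
      ((Scheme.Modules.pullback ι).obj F).presheaf.map ((Opens.map ι.base).map (homOfLE hWU)).op
        (basisSection (E := (Scheme.Modules.pullback ι).obj F) (pullbackFrame ι e) i) := by
    conv_lhs => rw [eq_sum_coord_smul e (homOfLE hWU) sW, unitSection_sum]
    refine Finset.sum_congr rfl fun i _ => ?_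
    rw [unitSection_smul, unitSection_map, basisSection_pullbackFrame, hc]
  have hc0 : ∀ j, ι.app W (c j) = 0 := fun j => by
    have h3 := coord_sum_smul_basisSection (E := (Scheme.Modules.pullback ι).obj F)
      (pullbackFrame ι e) ((Opens.map ι.base).map (homOfLE hWU)) (fun i => ι.app W (c i)) j
    rw [← hexp, hηsW, coord_zero] at h3
    exact h3.symm
  -- so `c_j = a|_W c'_j` and `s|_W = a · ∑ c'_j b_j|_W`
  choose c' hc' using fun j => hker W hWaff (c j) (hc0 j)
  refine ⟨∑ i, c' i • F.presheaf.map (homOfLE hWU).op (basisSection e i), ?_⟩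
  change (globalScalar F a).app W (∑ i, c' i • F.presheaf.map (homOfLE hWU).op (basisSection e i)) =
    F.presheaf.map (homOfLE hWV).op s
  rw [globalScalar_app_apply, Finset.smul_sum, ← hsW]
  conv_rhs => rw [eq_sum_coord_smul e (homOfLE hWU) sW, ← hc]
  refine Finset.sum_congr rfl fun i _ => ?_
  rw [smul_smul, ← hc' i]

/-! ## `ι_*ι^*F ≅ F/aF` -/

/-- **`ι_*ι^*F ≅ F/aF`**: for `ι : Z = V(a) → X` as in `exact_globalScalar_pullbackUnit` and `F`
finite locally free, the unit induces an isomorphism of the cokernel of multiplication by `a` on `F`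
with `ι_*ι^*F` (the finite-locally-free case of `i_*i^*𝓕 = 𝓕/𝓘𝓕`).
[cite: StacksProject, Tag 08KS (Modules, Lemma 17.13.4)] -/
def cokernelGlobalScalarIso {F : X.Modules} (hF : IsFiniteLocallyFree F)
    {a : Γ(X, ⊤)} (ha : ι.appTop a = 0)
    (hker : ∀ W : X.Opens, IsAffineOpen W → ∀ c : Γ(X, W), ι.app W c = 0 →
      ∃ c' : Γ(X, W), c = X.presheaf.map (homOfLE (le_top : W ≤ ⊤)).op a * c') :
    cokernel (globalScalar F a) ≅
      (Scheme.Modules.pushforward ι).obj ((Scheme.Modules.pullback ι).obj F) :=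
  haveI : Epi (ShortComplex.mk (globalScalar F a) (pullbackUnit ι F)
      (globalScalar_comp_pullbackUnit ι ha F)).g := epi_pullbackUnit ι hF
  IsColimit.coconePointUniqueUpToIso (cokernelIsCokernel (globalScalar F a))
    (exact_globalScalar_pullbackUnit ι hF ha hker).gIsCokernel

/-- `coker(a) → ι_*ι^*F` is induced by the unit: `π ≫ ≅ = η_F`. [folklore] -/
@[reassoc]
theorem cokernel_π_cokernelGlobalScalarIso_hom {F : X.Modules} (hF : IsFiniteLocallyFree F)
    {a : Γ(X, ⊤)} (ha : ι.appTop a = 0)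
    (hker : ∀ W : X.Opens, IsAffineOpen W → ∀ c : Γ(X, W), ι.app W c = 0 →
      ∃ c' : Γ(X, W), c = X.presheaf.map (homOfLE (le_top : W ≤ ⊤)).op a * c') :
    cokernel.π (globalScalar F a) ≫ (cokernelGlobalScalarIso ι hF ha hker).hom = pullbackUnit ι F :=
  IsColimit.comp_coconePointUniqueUpToIso_hom (cokernelIsCokernel (globalScalar F a)) _
    WalkingParallelPair.one

/-- Equivalently `η_F ≫ ≅⁻¹ = π`. [folklore] -/
@[reassoc]
theorem pullbackUnit_cokernelGlobalScalarIso_inv {F : X.Modules} (hF : IsFiniteLocallyFree F)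
    {a : Γ(X, ⊤)} (ha : ι.appTop a = 0)
    (hker : ∀ W : X.Opens, IsAffineOpen W → ∀ c : Γ(X, W), ι.app W c = 0 →
      ∃ c' : Γ(X, W), c = X.presheaf.map (homOfLE (le_top : W ≤ ⊤)).op a * c') :
    pullbackUnit ι F ≫ (cokernelGlobalScalarIso ι hF ha hker).inv = cokernel.π (globalScalar F a) := by
  rw [← cokernel_π_cokernelGlobalScalarIso_hom ι hF ha hker, Category.assoc, Iso.hom_inv_id,
    Category.comp_id]

/-- **Uniqueness of the factorisation**: a morphism `φ : F → G` killed by `a` (`a ∘ φ = 0`, e.g. any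
morphism to a direct image `ι_*P`, `globalScalar_pushforward_eq_zero`) factors uniquely through
`η_F : F → ι_*ι^*F`. [folklore] -/
theorem existsUnique_pullbackUnit_desc {F G : X.Modules} (hF : IsFiniteLocallyFree F)
    {a : Γ(X, ⊤)} (ha : ι.appTop a = 0)
    (hker : ∀ W : X.Opens, IsAffineOpen W → ∀ c : Γ(X, W), ι.app W c = 0 →
      ∃ c' : Γ(X, W), c = X.presheaf.map (homOfLE (le_top : W ≤ ⊤)).op a * c')
    (φ : F ⟶ G) (hφ : globalScalar F a ≫ φ = 0) :
    ∃! ψ : (Scheme.Modules.pushforward ι).obj ((Scheme.Modules.pullback ι).obj F) ⟶ G,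
      pullbackUnit ι F ≫ ψ = φ := by
  haveI := epi_pullbackUnit ι hF
  refine ⟨(cokernelGlobalScalarIso ι hF ha hker).inv ≫ cokernel.desc _ φ hφ, ?_, fun ψ hψ => ?_⟩
  · dsimp only
    rw [pullbackUnit_cokernelGlobalScalarIso_inv_assoc, cokernel.π_desc]
  · rw [← cancel_epi (pullbackUnit ι F), hψ, pullbackUnit_cokernelGlobalScalarIso_inv_assoc,
      cokernel.π_desc]

end Literature.AlgebraicGeometry.Modules

end
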